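import Mathlib
import Summits.MatrixMultiplication.MatrixMultiplication.Theses.AutomaticSTPPDesigns
import Summits.MatrixMultiplication.MatrixMultiplication.Theorems.AutomaticSTPPDesignsNontrivialAllScalesFamily
import Literature.Combinatorics.Additive.TripleProductProperty
import Literature.Computability.AlgebraicComplexity.GroupTheoreticMatMul
import Literature.Computability.AutomaticStructures.AutomaticBlock

/-!
# `AutomaticDesignBelowFourFifths` — reduction to ONE finite cyclic design (extension-product collapse)

Route `MatrixMultiplication/AutomaticSTPPDesigns`, crux `stmt-MatrixMultiplication-7357`
(`AutomaticDesignBelowFourFifths`), line `Sketch` (idea card `extension-product-collapse`).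

The crux asks for a base `p ≥ 2` and three regular languages whose all-scales block family is STPP
in every `ℤ/(p^k)` and beats the host at exponent `4/5` at infinitely many scales. This file proves
the TRANSFER half of the line: the crux follows from a single finite object,

  `C⁺ :  ∃ N ≥ 2, ∃ (Aᵢ, Bᵢ, Cᵢ)_{i<n}` STPP in `ℤ/N` with `N < ∑ᵢ (|Aᵢ||Bᵢ||Cᵢ|)^{4/5}`,

and conversely the crux gives `C⁺` back (so the two are EQUIVALENT, and the automaton / all-scales /
infinitely-often clauses of the crux carry no extra content).

* `allScales_of_digitDesign_rpow` — digit designs lift to all scales with MULTIPLICATIVE packing sum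
  at every real exponent `τ`: if digit sets `(D^A_i, D^B_i, D^C_i)_{i ∈ ι}` in `Fin p` form an STPP
  family in `ℤ/p` with `p < ∑ᵢ (|D^A_i||D^B_i||D^C_i|)^τ`, the three letterwise languages (regular,
  two-state automata) have an STPP block family in every `ℤ/(p^k)` (the carry induction
  `NontrivialAllScalesFamily.digits_eq_of_pow_dvd` of the sibling file: the lowest digit's relation
  is the design's own relation mod `p`, forces equal indices and digits, hence cancels exactly and no
  carry is ever created — Cohn–Kleinberg–Szegedy–Umans 2005 Lemma 5.4 along the extension
  `0 → pℤ/p^{k+1} → ℤ/p^{k+1} → ℤ/p → 0` instead of a direct product) and packing sum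
  `∑_w (|A_w||B_w||C_w|)^τ = (∑ᵢ (|D^A_i||D^B_i||D^C_i|)^τ)^k > p^k` at every `k ≥ 1`.
* `crux_of_cyclicDesign` — `C⁺ →` the crux (base `p := N`, index alphabet `Fin n`, digits = `ZMod.val`).
* `cyclicDesign_of_crux` — the crux `→ C⁺` (a beating scale `k ≥ 1` is a finite STPP design in
  `ℤ/p^k`, reindexed along `Fintype.equivFin`).

## References

* H. Cohn, R. Kleinberg, B. Szegedy, C. Umans, *Group-theoretic algorithms for matrix
  multiplication*, FOCS 2005, arXiv:math/0511460: Def. 5.1 (STPP), Lemma 5.4 (products of STPP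
  families), Thm. 5.5.
-/

-- single-conjunct summit: the mandated namespace repeats `MatrixMultiplication`.
set_option linter.dupNamespace false

noncomputable section

namespace Summit.MatrixMultiplication.MatrixMultiplication.Theorems

namespace AutomaticDesignBelowFourFifths

open Finset Literature.Combinatorics.Additive Literature.Computability.AutomaticStructures
  NontrivialAllScalesFamily

/-! ### Digit designs lift to all scales, with multiplicative packing sum at exponent `τ` -/

/-- **Digit designs lift to all scales (real exponent).** If digit sets `(D^A_i, D^B_i, D^C_i)_{i ∈ ι}`
in `Fin p` (`p ≥ 2`) form an STPP family in `ℤ/p` with `p < ∑ᵢ (|D^A_i||D^B_i||D^C_i|)^τ`, then the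
three letterwise languages are regular, their block family is STPP in `ℤ/(p^k)` at every scale `k`
(carry induction), and `p^k < ∑_w (|A_w||B_w||C_w|)^τ = (∑ᵢ (|D^A_i||D^B_i||D^C_i|)^τ)^k` at every
scale `k ≥ 1`. (CKSU 2005 Lemma 5.4, taken along the `p`-adic filtration of `ℤ/p^k`.)
[cite: CohnKleinbergSzegedyUmans2005, Lemma 5.4] -/
theorem allScales_of_digitDesign_rpow {ι : Type} [Fintype ι] {p : ℕ} (hp : 2 ≤ p)
    (DA DB DC : ι → Finset (Fin p))
    (hD : AddSimultaneousTPP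
      (fun i => (DA i).image fun d : Fin p => ((d : ℕ) : ZMod p))
      (fun i => (DB i).image fun d : Fin p => ((d : ℕ) : ZMod p))
      (fun i => (DC i).image fun d : Fin p => ((d : ℕ) : ZMod p)))
    (τ : ℝ) (hmass : (p : ℝ) < ∑ i, (((DA i).card * (DB i).card * (DC i).card : ℕ) : ℝ) ^ τ) :
    ∃ LA LB LC : Language (ι × Fin p), LA.IsRegular ∧ LB.IsRegular ∧ LC.IsRegular ∧
      (∀ k : ℕ, AddSimultaneousTPP (automaticBlock p k LA) (automaticBlock p k LB)
        (automaticBlock p k LC)) ∧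
      ∀ k₀ : ℕ, ∃ k ≥ k₀, (p : ℝ) ^ k < ∑ w : Fin k → ι,
        (((automaticBlock p k LA w).card * (automaticBlock p k LB w).card *
          (automaticBlock p k LC w).card : ℕ) : ℝ) ^ τ := by
  haveI : NeZero p := ⟨by omega⟩
  refine ⟨(⟨fun b y => b && decide (y.2 ∈ DA y.1), true, {true}⟩ : DFA (ι × Fin p) Bool).accepts,
    (⟨fun b y => b && decide (y.2 ∈ DB y.1), true, {true}⟩ : DFA (ι × Fin p) Bool).accepts,
    (⟨fun b y => b && decide (y.2 ∈ DC y.1), true, {true}⟩ : DFA (ι × Fin p) Bool).accepts,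
    isRegular_letterwise DA, isRegular_letterwise DB, isRegular_letterwise DC, ?_⟩
  refine ⟨fun k => ?_, fun k₀ => ⟨k₀ + 1, Nat.le_succ _, ?_⟩⟩
  · haveI : NeZero (p ^ k) := ⟨pow_ne_zero _ (NeZero.ne p)⟩
    rw [addSimultaneousTPP_iff_forall]
    intro I J K s hs s' hs' t ht t' ht' u hu u' hu' h0
    simp only [automaticBlock_letterwise, mem_image, Fintype.mem_piFinset] at hs hs' ht ht' hu hu'
    obtain ⟨S, hS, rfl⟩ := hs
    obtain ⟨S', hS', rfl⟩ := hs'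
    obtain ⟨T, hT, rfl⟩ := ht
    obtain ⟨T', hT', rfl⟩ := ht'
    obtain ⟨U, hU, rfl⟩ := hu
    obtain ⟨U', hU', rfl⟩ := hu'
    rw [stppSum_eq_intCast, ZMod.intCast_zmod_eq_zero_iff_dvd, Nat.cast_pow] at h0
    obtain ⟨hIJ, hJK, hSS, hTT, hUU⟩ :=
      digits_eq_of_pow_dvd DA DB DC hD k I J K S S' T T' U U' hS hS' hT hT' hU hU' h0
    exact ⟨hIJ, hJK, by rw [hSS], by rw [hTT], by rw [hUU]⟩
  · -- the packing sum at scale `k₀ + 1` is the `(k₀ + 1)`-st power of the digit design's sum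
    have hcard : ∀ (D : ι → Finset (Fin p)) (w : Fin (k₀ + 1) → ι),
        (automaticBlock p (k₀ + 1)
          (⟨fun b y => b && decide (y.2 ∈ D y.1), true, {true}⟩ : DFA (ι × Fin p) Bool).accepts
            w).card = ∏ j, (D (w j)).card := by
      intro D w
      rw [automaticBlock_letterwise, card_image_of_injective _ (natCast_digitValue_injective p _),
        Fintype.card_piFinset]
    have hterm : ∀ w : Fin (k₀ + 1) → ι,
        (((∏ j, (DA (w j)).card) * (∏ j, (DB (w j)).card) * (∏ j, (DC (w j)).card) : ℕ) : ℝ) ^ τ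
          = ∏ j, (((DA (w j)).card * (DB (w j)).card * (DC (w j)).card : ℕ) : ℝ) ^ τ := by
      intro w
      rw [← prod_mul_distrib, ← prod_mul_distrib, Nat.cast_prod,
        ← Real.finsetProd_rpow _ _ (fun j _ => by positivity)]
    simp only [hcard, hterm]
    have hp0 : (0 : ℝ) ≤ p := by positivity
    calc (p : ℝ) ^ (k₀ + 1)
        < (∑ i, (((DA i).card * (DB i).card * (DC i).card : ℕ) : ℝ) ^ τ) ^ (k₀ + 1) :=
          pow_lt_pow_left₀ hmass hp0 (Nat.succ_ne_zero _)
      _ = _ := by rw [Finset.sum_pow', Fintype.piFinset_univ]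

/-! ### `C⁺ →` crux -/

/-- **The crux from one finite cyclic design** (`C⁺ → AutomaticDesignBelowFourFifths`): an STPP family
`(Aᵢ, Bᵢ, Cᵢ)_{i<n}` in `ℤ/N` (`N ≥ 2`, the tree's `IsSTPP`) with `N < ∑ᵢ (|Aᵢ||Bᵢ||Cᵢ|)^{4/5}` yields,
in base `p := N` with index alphabet `Fin n`, three regular (letterwise) languages whose block family
is STPP in every `ℤ/(N^k)` and beats `N^k` at exponent `4/5` at every scale `k ≥ 1` (digits are read
off by `ZMod.val`; `allScales_of_digitDesign_rpow`). [cite: CohnKleinbergSzegedyUmans2005, Lemma 5.4] -/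
theorem crux_of_cyclicDesign
    (h : ∃ (N n : ℕ), 2 ≤ N ∧ ∃ A B C : Fin n → Finset (ZMod N),
      Literature.Computability.AlgebraicComplexity.IsSTPP A B C ∧
      (N : ℝ) < ∑ i, (((A i).card * (B i).card * (C i).card : ℕ) : ℝ) ^ ((4 : ℝ) / 5)) :
    Summit.MatrixMultiplication.MatrixMultiplication.Theses.AutomaticSTPPDesigns.AutomaticDesignBelowFourFifths := by
  unfold
    Summit.MatrixMultiplication.MatrixMultiplication.Theses.AutomaticSTPPDesigns.AutomaticDesignBelowFourFifths
  obtain ⟨N, n, hN, A, B, C, hS, hmass⟩ := h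
  haveI : NeZero N := ⟨by omega⟩
  -- read the elements of `ℤ/N` as digits `Fin N`
  let ψ : ZMod N → Fin N := fun x => ⟨x.val, ZMod.val_lt x⟩
  have hψ : ∀ x, (((ψ x : Fin N) : ℕ) : ZMod N) = x := fun x => ZMod.natCast_zmod_val x
  have hψinj : Function.Injective ψ := fun x y hxy => by rw [← hψ x, ← hψ y, hxy]
  have himg : ∀ s : Finset (ZMod N),
      (s.image ψ).image (fun d : Fin N => ((d : ℕ) : ZMod N)) = s := by
    intro s
    rw [Finset.image_image]
    conv_rhs => rw [← Finset.image_id (s := s)]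
    exact Finset.image_congr fun x _ => hψ x
  have hD : AddSimultaneousTPP
      (fun i => ((A i).image ψ).image fun d : Fin N => ((d : ℕ) : ZMod N))
      (fun i => ((B i).image ψ).image fun d : Fin N => ((d : ℕ) : ZMod N))
      (fun i => ((C i).image ψ).image fun d : Fin N => ((d : ℕ) : ZMod N)) := by
    simp only [himg]
    exact (addSimultaneousTPP_iff_forall A B C).2 hS
  have hmass' : (N : ℝ) < ∑ i, ((((A i).image ψ).card * ((B i).image ψ).card *
      ((C i).image ψ).card : ℕ) : ℝ) ^ ((4 : ℝ) / 5) := by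
    simpa only [card_image_of_injective _ hψinj] using hmass
  obtain ⟨LA, LB, LC, hA, hB, hC, hall⟩ :=
    allScales_of_digitDesign_rpow hN _ _ _ hD ((4 : ℝ) / 5) hmass'
  exact ⟨N, Fin n, inferInstance, LA, LB, LC, hN, hA, hB, hC, hall⟩

/-! ### crux `→ C⁺` -/

/-- **One finite cyclic design from the crux** (`AutomaticDesignBelowFourFifths → C⁺`): at a scale
`k ≥ 1` where the regular family beats `p^k`, the level-`k` blocks ARE a finite STPP family in
`ℤ/N`, `N := p^k ≥ 2`, with `N < ∑ (|A||B||C|)^{4/5}`; reindex the index words along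
`Fintype.equivFin`. Together with `crux_of_cyclicDesign` the crux is equivalent to `C⁺`. [folklore] -/
theorem cyclicDesign_of_crux
    (h : Summit.MatrixMultiplication.MatrixMultiplication.Theses.AutomaticSTPPDesigns.AutomaticDesignBelowFourFifths) :
    ∃ (N n : ℕ), 2 ≤ N ∧ ∃ A B C : Fin n → Finset (ZMod N),
      Literature.Computability.AlgebraicComplexity.IsSTPP A B C ∧
      (N : ℝ) < ∑ i, (((A i).card * (B i).card * (C i).card : ℕ) : ℝ) ^ ((4 : ℝ) / 5) := by
  unfold
    Summit.MatrixMultiplication.MatrixMultiplication.Theses.AutomaticSTPPDesigns.AutomaticDesignBelowFourFifths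
    at h
  obtain ⟨p, ι, _, LA, LB, LC, hp, -, -, -, hS, hbeat⟩ := h
  obtain ⟨k, hk1, hk⟩ := hbeat 1
  -- the level-`k` family, reindexed by `Fin n`
  classical
  set e : Fin (Fintype.card (Fin k → ι)) ≃ (Fin k → ι) := (Fintype.equivFin (Fin k → ι)).symm
    with he
  refine ⟨p ^ k, Fintype.card (Fin k → ι), ?_, fun i => automaticBlock p k LA (e i),
    fun i => automaticBlock p k LB (e i), fun i => automaticBlock p k LC (e i), ?_, ?_⟩
  · calc 2 ≤ p := hp
      _ = p ^ 1 := (pow_one p).symm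
      _ ≤ p ^ k := Nat.pow_le_pow_right (by omega) hk1
  · have hSk := hS k
    rw [addSimultaneousTPP_iff_forall] at hSk
    intro i j l s hs s' hs' t ht t' ht' u hu u' hu' h0
    obtain ⟨hij, hjl, rest⟩ := hSk (e i) (e j) (e l) s hs s' hs' t ht t' ht' u hu u' hu' h0
    exact ⟨e.injective hij, e.injective hjl, rest⟩
  · rw [Nat.cast_pow]
    calc ((p : ℝ)) ^ k < ∑ w : Fin k → ι, (((automaticBlock p k LA w).card *
          (automaticBlock p k LB w).card * (automaticBlock p k LC w).card : ℕ) : ℝ) ^ ((4 : ℝ) / 5) :=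
          hk
      _ = _ := (e.sum_comp (fun w => (((automaticBlock p k LA w).card *
          (automaticBlock p k LB w).card * (automaticBlock p k LC w).card : ℕ) : ℝ) ^
            ((4 : ℝ) / 5))).symm

/-! ### The registered stub of the skeleton (Lines/Sketch.lean), by name -/

/-- **`stub_transfer` of the registered skeleton** (crux `stmt-MatrixMultiplication-7357`, line `Sketch`),
literally: C⁺ → `AutomaticDesignBelowFourFifths`; it is `crux_of_cyclicDesign`.
[cite: CohnKleinbergSzegedyUmans2005, Lemma 5.4] -/
theorem stub_transfer
    (h : ∃ (N n : ℕ), 2 ≤ N ∧ ∃ A B C : Fin n → Finset (ZMod N),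
      Literature.Computability.AlgebraicComplexity.IsSTPP A B C ∧
      (N : ℝ) < ∑ i, (((A i).card * (B i).card * (C i).card : ℕ) : ℝ) ^ ((4 : ℝ) / 5)) :
    Summit.MatrixMultiplication.MatrixMultiplication.Theses.AutomaticSTPPDesigns.AutomaticDesignBelowFourFifths :=
  crux_of_cyclicDesign h

end AutomaticDesignBelowFourFifths

end Summit.MatrixMultiplication.MatrixMultiplication.Theorems
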